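import Summits.QuantumFields.YangMills.Theorems.SmallCircleAnchorAnchorGapStubDebyeScreening9
import Summits.QuantumFields.YangMills.Theorems.SmallCircleAnchorAnchorGapStubDebyeScreening13

/-!
# Crux `AnchorGap` (stmt-QuantumFields-11141), line `registered` — the `ε = 0` cell ensemble is well-posed (soft layer under stub DSred)

The neutral lattice sine-Gordon gas with compact zero mode — the `ε → 0` limit at fixed volume of the
regulated gas of stub DSred (`stub_debyeScreening`) — is the measure
`∝ 1_{D_b}(θ̄(φ)) · weight α g 0 ζ φ dφ` on configurations (`D_b` the fundamental cell of the
commensurate dual basis `b`, `θ̄` the zero mode; all vocabulary of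
`Literature.Probability.LatticeModels.LatticeSineGordon`, no new definition).  This file shows it is
well-posed for `g ≠ 0`:

* `integrable_indicator_weight_zero`, `integrable_indicator_weight_zero_mul_fluct` — the cell weight
  and its fluctuation second moment `Σ_p (φ_p − θ̄_{p.2})²` are integrable: on the cell the zero mode
  is bounded and the discrete Poincaré inequality (`torus_poincare`, `sum_sq_sub_zeroMode`) lets the
  gradient energy dominate a product Gaussian;
* `integral_indicator_weight_zero_pos` — its mass is positive (the cell contains an open set);
* `abs_cellExpect_le` — cell expectations of measurable `|H| ≤ 1` are bounded by `1`.

With the sequel (`…StubDebyeScreening15`: the flat reference ensemble at `ε ≤ ε₀(N)` is within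
`O(ε)` of the cell ensemble in total variation on the parameter box) the remaining core of DSred
becomes a statement about this single `ε`-free measure.
-/

set_option autoImplicit false

noncomputable section

namespace Summit.QuantumFields.YangMills.Theorems.AnchorGap

open MeasureTheory Finset
open Literature.Probability.LatticeModels

/-- `(1 + t) e^{-c t} ≤ (1 + 2/c) e^{-c t / 2}` for `t ≥ 0`, `c > 0`. -/
private lemma one_add_mul_exp_le {c t : ℝ} (hc : 0 < c) (ht : 0 ≤ t) :
    (1 + t) * Real.exp (-(c * t)) ≤ (1 + 2 / c) * Real.exp (-(c * t / 2)) := by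
  have h1 : 1 + c * t / 2 ≤ Real.exp (c * t / 2) := by
    have := Real.add_one_le_exp (c * t / 2); linarith
  have h2 : 1 + t ≤ (1 + 2 / c) * Real.exp (c * t / 2) := by
    calc 1 + t ≤ (1 + 2 / c) * (1 + c * t / 2) := by
          have : (1 + 2 / c) * (1 + c * t / 2) = 1 + t + (2 / c + c * t / 2) := by field_simp; ring
          rw [this]
          have : 0 ≤ 2 / c + c * t / 2 := by positivity
          linarith
      _ ≤ (1 + 2 / c) * Real.exp (c * t / 2) := mul_le_mul_of_nonneg_left h1 (by positivity)
  have h3 : Real.exp (-(c * t)) = Real.exp (-(c * t / 2)) * Real.exp (-(c * t / 2)) := by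
    rw [← Real.exp_add]; ring_nf
  have h4 : Real.exp (c * t / 2) * Real.exp (-(c * t / 2)) = 1 := by
    rw [← Real.exp_add, add_neg_cancel, Real.exp_zero]
  calc (1 + t) * Real.exp (-(c * t)) = (1 + t) * Real.exp (-(c * t / 2)) * Real.exp (-(c * t / 2)) := by
        rw [h3]; ring
    _ ≤ ((1 + 2 / c) * Real.exp (c * t / 2)) * Real.exp (-(c * t / 2)) * Real.exp (-(c * t / 2)) := by
        gcongr
    _ = (1 + 2 / c) * Real.exp (-(c * t / 2)) := by
        rw [mul_assoc (1 + 2 / c), h4, mul_one]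

/-- Domination of the `ε = 0` weight on the zero-mode cell by a product Gaussian: the engine of the
integrability statements below. -/
private lemma indicator_weight_zero_dominated {d N k : ℕ} [NeZero N] {ι : Type} [Fintype ι]
    (α : ι → Fin k → ℝ) (b : Fin k → Fin k → ℝ) (hb : LinearIndependent ℝ b) {g : ℝ} (hg : g ≠ 0) (ζ : ℝ)
    (Φ : LatticeSineGordon.Config d N k → ℝ) (hΦm : Measurable Φ)
    (hΦ : ∀ φ, |Φ φ| ≤ 1 + ∑ p : TorusSite d N × Fin k, φ p ^ 2) :
    Integrable ({φ : LatticeSineGordon.Config d N k | ∃ t : Fin k → ℝ, (∀ j : Fin k, 0 ≤ t j ∧ t j < 1) ∧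
      ∀ a : Fin k, (Fintype.card (TorusSite d N) : ℝ)⁻¹ * ∑ x : TorusSite d N, φ (x, a) = ∑ j : Fin k, t j * b j a}.indicator
      (fun φ => LatticeSineGordon.weight α g 0 ζ φ * Φ φ)) := by
  set S : Set (LatticeSineGordon.Config d N k) := {φ | ∃ t : Fin k → ℝ, (∀ j : Fin k, 0 ≤ t j ∧ t j < 1) ∧
    ∀ a : Fin k, (Fintype.card (TorusSite d N) : ℝ)⁻¹ * ∑ x : TorusSite d N, φ (x, a) = ∑ j : Fin k, t j * b j a} with hS
  set V : ℝ := (Fintype.card (TorusSite d N) : ℝ) with hV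
  have hVpos : 0 < V := by
    rw [hV]; exact_mod_cast Fintype.card_pos
  set Bc : ℝ := ∑ c : Fin k, (∑ j : Fin k, |b j c|) ^ 2 with hBc
  -- Poincaré constant (shifted by one to stay positive in degenerate dimensions)
  set CP : ℝ := V * k * (((d : ℝ) * N) ^ 2) + 1 with hCP
  have hCPpos : 0 < CP := by rw [hCP]; positivity
  have hg2 : 0 < g ^ 2 := lt_of_le_of_ne (sq_nonneg g) (Ne.symm (pow_ne_zero 2 hg))
  set c : ℝ := (2 * g ^ 2 * CP)⁻¹ with hc
  have hcpos : 0 < c := by rw [hc]; positivity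
  set K : ℝ := Real.exp (2 * |ζ| * (Fintype.card (TorusSite d N) * Fintype.card ι)) *
    Real.exp (c * (V * Bc)) * (1 + 2 / c) with hK
  -- the dominating product Gaussian
  have hprod : Integrable (fun φ : LatticeSineGordon.Config d N k =>
      K * ∏ p : TorusSite d N × Fin k, Real.exp (-(c / 2) * φ p ^ 2)) := by
    refine Integrable.const_mul ?_ K
    exact Integrable.fintype_prod (f := fun _ : TorusSite d N × Fin k => fun t : ℝ =>
      Real.exp (-(c / 2) * t ^ 2)) fun _ => integrable_exp_neg_mul_sq (by positivity)
  have hSmeas : MeasurableSet S := measurableSet_zeroModeCell d N k b hb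
  have hmeas : AEStronglyMeasurable (S.indicator (fun φ => LatticeSineGordon.weight α g 0 ζ φ * Φ φ)) volume :=
    (((LatticeSineGordon.continuous_weight (d := d) (N := N) α g 0 ζ).measurable.mul hΦm).indicator
      hSmeas).aestronglyMeasurable
  refine hprod.mono' hmeas (Filter.Eventually.of_forall fun φ => ?_)
  by_cases hφ : φ ∈ S
  swap
  · rw [Set.indicator_of_notMem hφ, norm_zero]
    exact mul_nonneg (by rw [hK]; positivity) (prod_nonneg fun _ _ => (Real.exp_pos _).le)
  rw [Set.indicator_of_mem hφ, Real.norm_eq_abs, abs_mul, abs_of_pos (LatticeSineGordon.weight_pos _ _ _ _ _)]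
  -- gradient energy and the `ε = 0` action
  set G : ℝ := ∑ z : TorusSite d N, ∑ j : Fin d, ∑ a' : Fin k, (φ (z + Pi.single j 1, a') - φ (z, a')) ^ 2 with hG
  have hG0 : 0 ≤ G := sum_nonneg fun _ _ => sum_nonneg fun _ _ => sum_nonneg fun _ _ => sq_nonneg _
  have hact : LatticeSineGordon.gaussianAction g 0 φ = (2 * g ^ 2)⁻¹ * G := by
    unfold LatticeSineGordon.gaussianAction
    rw [zero_mul, add_zero]
  set Q : ℝ := ∑ p : TorusSite d N × Fin k, φ p ^ 2 with hQ
  have hQ0 : 0 ≤ Q := sum_nonneg fun _ _ => sq_nonneg _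
  -- Poincaré + variance identity + cell bound: `G ≥ (Q − V Bc) / CP`
  have hP := torus_poincare d N k φ
  have hvar := sum_sq_sub_zeroMode d N k φ
  have hcell := zeroModeCell_normSq_le d N k b φ hφ
  have hθ : V⁻¹ * ∑ a : Fin k, (∑ x : TorusSite d N, φ (x, a)) ^ 2 ≤ V * Bc := by
    have : V⁻¹ * ∑ a : Fin k, (∑ x : TorusSite d N, φ (x, a)) ^ 2 =
        V * ∑ c₁ : Fin k, (V⁻¹ * ∑ x : TorusSite d N, φ (x, c₁)) ^ 2 := by
      rw [mul_sum, mul_sum]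
      exact sum_congr rfl fun c₁ _ => by field_simp
    rw [this]
    exact mul_le_mul_of_nonneg_left hcell hVpos.le
  have hGlow : Q - V * Bc ≤ CP * G := by
    have h1 : ∑ p : TorusSite d N × Fin k, (φ p - V⁻¹ * ∑ y : TorusSite d N, φ (y, p.2)) ^ 2 ≤ CP * G := by
      calc _ ≤ V * k * (((d : ℝ) * N) ^ 2 * G) := hP
        _ ≤ CP * G := by rw [hCP]; nlinarith
    rw [← hvar] at h1
    linarith
  -- the weight on the cell
  have hw : LatticeSineGordon.weight α g 0 ζ φ ≤
      Real.exp (2 * |ζ| * (Fintype.card (TorusSite d N) * Fintype.card ι)) * Real.exp (c * (V * Bc)) *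
        Real.exp (-(c * Q)) := by
    rw [LatticeSineGordon.weight, ← Real.exp_add, ← Real.exp_add]
    refine Real.exp_le_exp.2 ?_
    have ht := (abs_le.1 (LatticeSineGordon.abs_tilt_le (d := d) (N := N) α ζ φ)).2
    rw [hact]
    have h2 : c * Q - c * (V * Bc) ≤ (2 * g ^ 2)⁻¹ * G := by
      have : c * (Q - V * Bc) ≤ c * (CP * G) := mul_le_mul_of_nonneg_left hGlow hcpos.le
      have e : c * (CP * G) = (2 * g ^ 2)⁻¹ * G := by rw [hc]; field_simp
      linarith
    linarith
  -- assemble the domination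
  have hexpQ : Real.exp (-(c * Q / 2)) = ∏ p : TorusSite d N × Fin k, Real.exp (-(c / 2) * φ p ^ 2) := by
    rw [← Real.exp_sum, hQ]
    congr 1
    rw [mul_sum, Finset.sum_div, ← sum_neg_distrib]
    exact sum_congr rfl fun p _ => by ring
  calc LatticeSineGordon.weight α g 0 ζ φ * |Φ φ|
      ≤ (Real.exp (2 * |ζ| * (Fintype.card (TorusSite d N) * Fintype.card ι)) * Real.exp (c * (V * Bc)) *
          Real.exp (-(c * Q))) * (1 + Q) :=
        mul_le_mul hw (hΦ φ) (abs_nonneg _) (by positivity)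
    _ = Real.exp (2 * |ζ| * (Fintype.card (TorusSite d N) * Fintype.card ι)) * Real.exp (c * (V * Bc)) *
          ((1 + Q) * Real.exp (-(c * Q))) := by ring
    _ ≤ Real.exp (2 * |ζ| * (Fintype.card (TorusSite d N) * Fintype.card ι)) * Real.exp (c * (V * Bc)) *
          ((1 + 2 / c) * Real.exp (-(c * Q / 2))) :=
        mul_le_mul_of_nonneg_left (one_add_mul_exp_le hcpos hQ0) (by positivity)
    _ = K * ∏ p : TorusSite d N × Fin k, Real.exp (-(c / 2) * φ p ^ 2) := by
        rw [hK, hexpQ]; ring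

/-- **The `ε = 0` weight is integrable on the zero-mode cell.** For `g ≠ 0` and any `ζ`,
`1_{D_b}(θ̄) · weight α g 0 ζ` is Lebesgue integrable on configurations: on the cell the zero mode is
bounded, the fluctuation is controlled by the gradient energy (`torus_poincare`), so the weight is
dominated by a product Gaussian.  This is the well-posedness of the neutral gas with compact zero
mode (the `ε → 0` limit of the regulated gas at fixed volume). [folklore] -/
theorem integrable_indicator_weight_zero :
    ∀ (d N k : ℕ) [NeZero N] (ι : Type) [Fintype ι] (α : ι → Fin k → ℝ) (b : Fin k → Fin k → ℝ), LinearIndependent ℝ b → ∀ (g ζ : ℝ), g ≠ 0 → Integrable ({φ : LatticeSineGordon.Config d N k | ∃ t : Fin k → ℝ, (∀ j : Fin k, 0 ≤ t j ∧ t j < 1) ∧ ∀ a : Fin k, (Fintype.card (TorusSite d N) : ℝ)⁻¹ * ∑ x : TorusSite d N, φ (x, a) = ∑ j : Fin k, t j * b j a}.indicator (fun φ => LatticeSineGordon.weight α g 0 ζ φ)) := by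
  intro d N k _ ι _ α b hb g ζ hg
  have h := indicator_weight_zero_dominated (d := d) (N := N) α b hb hg ζ (fun _ => (1 : ℝ)) measurable_const
    (fun φ => by rw [abs_one]; exact le_add_of_nonneg_right (sum_nonneg fun _ _ => sq_nonneg _))
  simpa only [mul_one] using h

/-- **Second moments of the fluctuation under the `ε = 0` cell weight are finite**:
`1_{D_b}(θ̄) · weight α g 0 ζ · Σ_p (φ_p − θ̄_{p.2})²` is integrable (`g ≠ 0`). [folklore] -/
theorem integrable_indicator_weight_zero_mul_fluct :
    ∀ (d N k : ℕ) [NeZero N] (ι : Type) [Fintype ι] (α : ι → Fin k → ℝ) (b : Fin k → Fin k → ℝ), LinearIndependent ℝ b → ∀ (g ζ : ℝ), g ≠ 0 → Integrable ({φ : LatticeSineGordon.Config d N k | ∃ t : Fin k → ℝ, (∀ j : Fin k, 0 ≤ t j ∧ t j < 1) ∧ ∀ a : Fin k, (Fintype.card (TorusSite d N) : ℝ)⁻¹ * ∑ x : TorusSite d N, φ (x, a) = ∑ j : Fin k, t j * b j a}.indicator (fun φ => LatticeSineGordon.weight α g 0 ζ φ * ∑ p : TorusSite d N × Fin k, (φ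 p - (Fintype.card (TorusSite d N) : ℝ)⁻¹ * ∑ y : TorusSite d N, φ (y, p.2)) ^ 2)) := by
  intro d N k _ ι _ α b hb g ζ hg
  refine indicator_weight_zero_dominated α b hb hg ζ _ (by fun_prop) fun φ => ?_
  have hvar := sum_sq_sub_zeroMode d N k φ
  have hnn : 0 ≤ ∑ p : TorusSite d N × Fin k, (φ p - (Fintype.card (TorusSite d N) : ℝ)⁻¹ * ∑ y : TorusSite d N, φ (y, p.2)) ^ 2 :=
    sum_nonneg fun _ _ => sq_nonneg _
  rw [abs_of_nonneg hnn, ← hvar]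
  have : 0 ≤ (Fintype.card (TorusSite d N) : ℝ)⁻¹ * ∑ a : Fin k, (∑ x : TorusSite d N, φ (x, a)) ^ 2 := by positivity
  linarith


/-- **The zero-mode cell has positive Lebesgue measure**: it contains the open non-empty set of
configurations all of whose zero-mode `b`-coordinates lie in `(0,1)`. [folklore] -/
theorem volume_zeroModeCell_pos :
    ∀ (d N k : ℕ) [NeZero N] (b : Fin k → Fin k → ℝ), LinearIndependent ℝ b → 0 < (volume : Measure (LatticeSineGordon.Config d N k)) {φ : LatticeSineGordon.Config d N k | ∃ t : Fin k → ℝ, (∀ j : Fin k, 0 ≤ t j ∧ t j < 1) ∧ ∀ a : Fin k, (Fintype.card (TorusSite d N) : ℝ)⁻¹ * ∑ x : TorusSite d N, φ (x, a) = ∑ j : Fin k, t j * b j a} := by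
  intro d N k _ b hb
  classical
  set S : Set (LatticeSineGordon.Config d N k) := {φ | ∃ t : Fin k → ℝ, (∀ j : Fin k, 0 ≤ t j ∧ t j < 1) ∧
    ∀ a : Fin k, (Fintype.card (TorusSite d N) : ℝ)⁻¹ * ∑ x : TorusSite d N, φ (x, a) = ∑ j : Fin k, t j * b j a} with hS
  set V : ℝ := (Fintype.card (TorusSite d N) : ℝ) with hV
  have hVpos : 0 < V := by
    rw [hV]; exact_mod_cast Fintype.card_pos
  let B := basisOfPiSpaceOfLinearIndependent hb
  have hB : ⇑B = b := coe_basisOfPiSpaceOfLinearIndependent hb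
  set θb : LatticeSineGordon.Config d N k → Fin k → ℝ := fun φ c => V⁻¹ * ∑ x, φ (x, c) with hθb
  set U : Set (LatticeSineGordon.Config d N k) :=
    (fun φ => B.equivFun (θb φ)) ⁻¹' Set.pi Set.univ (fun _ : Fin k => Set.Ioo (0 : ℝ) 1) with hU
  have hUS : U ⊆ S := by
    intro φ hφ
    simp only [hU, Set.mem_preimage, Set.mem_pi, Set.mem_univ, forall_true_left, Set.mem_Ioo,
      Module.Basis.equivFun_apply] at hφ
    refine ⟨fun j => B.repr (θb φ) j, fun j => ⟨(hφ j).1.le, (hφ j).2⟩, fun a => ?_⟩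
    show θb φ a = _
    conv_lhs => rw [← B.sum_repr (θb φ)]
    rw [Finset.sum_apply]
    simp [hB, smul_eq_mul]
  have hθb_cont : Continuous θb := by
    rw [hθb]; fun_prop
  have hUopen : IsOpen U := by
    refine IsOpen.preimage ?_ (isOpen_set_pi Set.finite_univ fun _ _ => isOpen_Ioo)
    exact (LinearMap.continuous_of_finiteDimensional (B.equivFun : (Fin k → ℝ) →ₗ[ℝ] Fin k → ℝ)).comp
      hθb_cont
  have hUne : U.Nonempty := by
    refine ⟨fun p => (∑ j, (1 / 2 : ℝ) • B j) p.2, ?_⟩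
    simp only [hU, Set.mem_preimage, Set.mem_pi, Set.mem_univ, forall_true_left, Set.mem_Ioo,
      Module.Basis.equivFun_apply]
    intro i
    have hθ : θb (fun p => (∑ j, (1 / 2 : ℝ) • B j) p.2) = ∑ j, (1 / 2 : ℝ) • B j := by
      funext c
      simp only [hθb, sum_const, card_univ, nsmul_eq_mul]
      rw [← hV]
      field_simp
    rw [hθ, Module.Basis.repr_sum_self]
    norm_num
  exact lt_of_lt_of_le (hUopen.measure_pos volume hUne) (measure_mono hUS)

/-- **The `ε = 0` cell ensemble is non-degenerate**: `∫ 1_{D_b}(θ̄) weight α g 0 ζ > 0` (`g ≠ 0`):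
the cell contains an open non-empty set of configurations and the weight is positive. [folklore] -/
theorem integral_indicator_weight_zero_pos :
    ∀ (d N k : ℕ) [NeZero N] (ι : Type) [Fintype ι] (α : ι → Fin k → ℝ) (b : Fin k → Fin k → ℝ), LinearIndependent ℝ b → ∀ (g ζ : ℝ), g ≠ 0 → 0 < ∫ φ : LatticeSineGordon.Config d N k, {φ : LatticeSineGordon.Config d N k | ∃ t : Fin k → ℝ, (∀ j : Fin k, 0 ≤ t j ∧ t j < 1) ∧ ∀ a : Fin k, (Fintype.card (TorusSite d N) : ℝ)⁻¹ * ∑ x : TorusSite d N, φ (x, a) = ∑ j : Fin k, t j * b j a}.indicator (fun φ => LatticeSineGordon.weight α g 0 ζ φ) φ := by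
  intro d N k _ ι _ α b hb g ζ hg
  have hint := integrable_indicator_weight_zero d N k ι α b hb g ζ hg
  rw [integral_pos_iff_support_of_nonneg (fun φ => Set.indicator_nonneg
    (fun ψ _ => (LatticeSineGordon.weight_pos _ _ _ _ ψ).le) φ) hint, Set.support_indicator]
  have hsupp : Function.support (fun φ : LatticeSineGordon.Config d N k => LatticeSineGordon.weight α g 0 ζ φ) = Set.univ :=
    Set.eq_univ_of_forall fun φ => (LatticeSineGordon.weight_pos _ _ _ _ φ).ne'
  rw [hsupp, Set.inter_univ]
  exact volume_zeroModeCell_pos d N k b hb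

/-- **Cell expectations of bounded observables are bounded**: for measurable `|H| ≤ 1`,
`|∫ 1_S H weight₀ / ∫ 1_S weight₀| ≤ 1` in the `ε = 0` cell ensemble (`g ≠ 0`). [folklore] -/
theorem abs_cellExpect_le :
    ∀ (d N k : ℕ) [NeZero N] (ι : Type) [Fintype ι] (α : ι → Fin k → ℝ) (b : Fin k → Fin k → ℝ), LinearIndependent ℝ b → ∀ (g ζ : ℝ), g ≠ 0 → ∀ (H : LatticeSineGordon.Config d N k → ℝ), Measurable H → (∀ φ, |H φ| ≤ 1) → let S : Set (LatticeSineGordon.Config d N k) := {φ | ∃ t : Fin k → ℝ, (∀ j : Fin k, 0 ≤ t j ∧ t j < 1) ∧ ∀ a : Fin k, (Fintype.card (TorusSite d N) : ℝ)⁻¹ * ∑ x : TorusSite d N, φ (x, a) = ∑ j : Fin k, t j * b j a}; |(∫ φ, S.indicator (fun φ => H φ * LatticeSineGordon.weight α g 0 ζ φ) φ) / ∫ φ, S.indicator (fun φ => LatticeSineGordon.weight α g 0 ζ φ) φ| ≤ 1 := by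
  intro d N k _ ι _ α b hb g ζ hg H hHm hH1 S
  have hZ : 0 < ∫ φ, S.indicator (fun φ => LatticeSineGordon.weight α g 0 ζ φ) φ :=
    integral_indicator_weight_zero_pos d N k ι α b hb g ζ hg
  have hint : Integrable (S.indicator (fun φ => LatticeSineGordon.weight α g 0 ζ φ)) :=
    integrable_indicator_weight_zero d N k ι α b hb g ζ hg
  have hf₀nn : ∀ φ, 0 ≤ S.indicator (fun φ => LatticeSineGordon.weight α g 0 ζ φ) φ := fun φ =>
    Set.indicator_nonneg (fun ψ _ => (LatticeSineGordon.weight_pos _ _ _ _ ψ).le) φ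
  have heq : ∀ φ, S.indicator (fun φ => H φ * LatticeSineGordon.weight α g 0 ζ φ) φ =
      H φ * S.indicator (fun φ => LatticeSineGordon.weight α g 0 ζ φ) φ := fun φ =>
    Set.indicator_mul_right S H _
  simp_rw [heq]
  have hHn : ∀ᵐ φ ∂(volume : Measure (LatticeSineGordon.Config d N k)), ‖H φ‖ ≤ 1 :=
    Filter.Eventually.of_forall fun φ => by rw [Real.norm_eq_abs]; exact hH1 φ
  have hiH : Integrable (fun φ => H φ * S.indicator (fun φ => LatticeSineGordon.weight α g 0 ζ φ) φ) :=
    hint.bdd_mul hHm.aestronglyMeasurable hHn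
  rw [abs_div, abs_of_pos hZ, div_le_one hZ]
  calc |∫ φ, H φ * S.indicator (fun φ => LatticeSineGordon.weight α g 0 ζ φ) φ|
      ≤ ∫ φ, |H φ * S.indicator (fun φ => LatticeSineGordon.weight α g 0 ζ φ) φ| := abs_integral_le_integral_abs
    _ ≤ ∫ φ, S.indicator (fun φ => LatticeSineGordon.weight α g 0 ζ φ) φ := integral_mono hiH.abs hint fun φ => by
        simp only []
        rw [abs_mul, abs_of_nonneg (hf₀nn φ)]
        exact mul_le_of_le_one_left (hf₀nn φ) (hH1 φ)

end Summit.QuantumFields.YangMills.Theorems.AnchorGap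

end
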